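import Literature.NumberTheory.EllipticCurves.BinaryQuarticGoodReductionSolubilityProofs
import Literature.NumberTheory.EllipticCurves.BinaryQuarticNodalReductionPointsProofs
import Literature.NumberTheory.EllipticCurves.BinaryQuarticDiscriminantFirstOrderProofs
import Literature.NumberTheory.EllipticCurves.BinaryQuarticFormsProofs
import HarnessLib

/-!
# Bhargava–Shankar, Prop. 5.13 / Prop. 3.18 (solubility half): a form that is not `ℚ_p`-soluble has
# `p² ∣ Δ(f)` — equivalently `p² ∤ Δ(f) ⇒ f` is `ℚ_p`-soluble — for every prime `p ≥ 5`

`Proofs` companion (theorems only: no definitions, no named facts) of `BinaryQuarticForms.lean`,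
assembling `BinaryQuarticGoodReductionSolubilityProofs` (`p ∤ Δ`),
`BinaryQuarticDoubleRootStructureProofs` + `BinaryQuarticNodalReductionPointsProofs` (the reduction
with `Δ ≡ 0`: triple root / `λq²` / a single rational double root with a smooth point next to it),
`BinaryQuarticDiscriminantFirstOrderProofs` (the deep strata force `p² ∣ 27Δ`) and the Hensel
lifting of `BinaryQuarticHenselSolubility`.

Source. M. Bhargava, A. Shankar, *Binary quartic forms having bounded invariants, and the
boundedness of the average rank of elliptic curves*, Ann. of Math. (2) 181 (2015) 191–242, proof
of Prop. 5.13 of the held arXiv text `arXiv:1006.1002v2` = **Prop. 3.18** of the published version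
(`arXiv:1006.1002v3`): *"if `f ∈ V_{ℤ_p}` is not `ℚ_p`-soluble [or `m_p(f) ≠ 1`], then
`p² ∣ Δ(f)`"*; there: "If `p² ∤ Δ(f)` then the splitting type of `f` at `p` is `(1111)`, `(112)`,
`(22)`, `(4)`, `(13)`, `(1²11)` or `(1²2)` … if `p ∤ Δ(f)` then `f` is `ℚ_p`-soluble; if the
splitting type is `(1²11)` … the single root lifts by Hensel's lemma." The weight half
(`m_p(f) ≠ 1 ⇒ p² ∣ Δ`) is `BinaryQuartic.sq_dvd_disc_of_twisted_diagonal_integral`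
(`BhargavaShankarEq31FrontierProofs`). Proved here, for every prime `p ≥ 5`:

* `BinaryQuartic.isSoluble_coe_of_not_sq_dvd_disc` — `f ∈ V_{ℤ_p}`, `p² ∤ Δ(f)` `⇒` `f` is
  `ℚ_p`-soluble; `BinaryQuartic.sq_dvd_disc_of_not_isSoluble` — the contrapositive as printed;
* `BinaryQuartic.isSoluble_padic_of_not_sq_dvd_disc` — the same for integral forms.

Proof. If `p ∣ I(f)` and `p ∣ J(f)` then `p² ∣ 4I³ − J² = 27Δ`. Otherwise `f̄ = f mod p ≠ 0`
has a non-zero value `f̄(x₀, 1)` (`p > 4` points), and after the `GL₂(ℤ_p)`-substitution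
`(x, y) ↦ (x₀x + y, x)` (which changes neither `Δ`, `I`, `J` nor solubility) `ā ≠ 0`; by the
structure theorem either `f̄ = λ̄q̄²` — then `f ≡ λq² (mod p)` for lifts and `p² ∣ 27Δ(f)` — or
`f̄ = (x − r̄y)²k̄` with `k̄(r̄) ≠ 0`, `disc k̄ ≠ 0`, where a smooth point of `z² = f̄(x,1)` exists
and lifts.

## References

* M. Bhargava, A. Shankar, Ann. of Math. (2) 181 (2015) 191–242 = arXiv:1006.1002, Prop. 5.13 of
  the arXiv v2 text = Prop. 3.18 of the published version, and its proof.
  [cite: BhargavaShankarAnnals2015, Prop. 5.13 (arXiv:1006.1002v2 numbering)]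
-/

noncomputable section

open scoped Classical
open Polynomial

namespace Literature.NumberTheory.EllipticCurves

namespace BinaryQuartic

variable {p : ℕ} [Fact p.Prime]

/-- **Hensel step with a given smooth point modulo `p`**: if `z̄² = f̄(t̄, 1)` in `𝔽_p` with
`z̄ ≠ 0` or `∂f̄/∂x(t̄, 1) ≠ 0` (`p ≠ 2`), then `f` is `ℚ_p`-soluble.
[cite: BhargavaShankarAnnals2015, Prop. 5.13, proof (arXiv:1006.1002v2 numbering)] -/
theorem isSoluble_coe_of_smooth_zmod_point (hp : p ≠ 2) (f : BinaryQuartic ℤ_[p]) {t z : ZMod p}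
    (h : z ^ 2 = (f.map PadicInt.toZMod).eval t 1)
    (hsmooth : z ≠ 0 ∨ 4 * (f.map PadicInt.toZMod).a * t ^ 3 + 3 * (f.map PadicInt.toZMod).b * t ^ 2
      + 2 * (f.map PadicInt.toZMod).c * t + (f.map PadicInt.toZMod).d ≠ 0) :
    (f.map PadicInt.Coe.ringHom).IsSoluble := by
  obtain ⟨t', ht'⟩ := ZMod.ringHom_surjective (PadicInt.toZMod (p := p)) t
  obtain ⟨w, hw⟩ := ZMod.ringHom_surjective (PadicInt.toZMod (p := p)) z
  have hred : PadicInt.toZMod (f.eval t' 1) = (f.map PadicInt.toZMod).eval t 1 := by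
    rw [← eval_map, ht', map_one]
  refine isSoluble_of_smooth_point_mod_p hp f (t := t') (w := w) ?_ ?_
  · rw [← toZMod_eq_zero_iff, map_sub, map_pow, hw, hred, h, sub_self]
  · rcases hsmooth with hz | hder
    · left
      rw [← toZMod_eq_zero_iff, hw]; exact hz
    · right
      rw [← toZMod_eq_zero_iff]
      simpa [ht', map_ofNat] using hder

/-- `27` is a unit in `ℤ_p` for `p ≥ 5`, so `p² ∣ 27Δ` gives `p² ∣ Δ`. [folklore] -/
theorem sq_dvd_of_sq_dvd_twentySeven_mul (hp : 5 ≤ p) {x : ℤ_[p]} (h : (p : ℤ_[p]) ^ 2 ∣ 27 * x) :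
    (p : ℤ_[p]) ^ 2 ∣ x := by
  have h27 : IsUnit (27 : ℤ_[p]) := by
    rw [PadicInt.isUnit_iff]
    have hle := PadicInt.norm_le_one (27 : ℤ_[p])
    have hlt : ¬ ‖(27 : ℤ_[p])‖ < 1 := by
      intro hlt
      have : ‖((27 : ℤ) : ℤ_[p])‖ < 1 := by exact_mod_cast hlt
      rw [PadicInt.norm_int_lt_one_iff_dvd] at this
      have h3 : (p : ℤ) ∣ 3 ^ 3 := by norm_num; exact this
      have := Int.Prime.dvd_pow' (Fact.out : p.Prime) h3
      have := Int.le_of_dvd (by norm_num) this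
      omega
    exact le_antisymm hle (not_lt.mp hlt)
  exact (IsUnit.dvd_mul_left h27).mp h

/-- **Bhargava–Shankar, Prop. 5.13 / Prop. 3.18, solubility half: `p² ∤ Δ(f)` implies that `f` is
`ℚ_p`-soluble**, for `f ∈ V_{ℤ_p}` and every prime `p ≥ 5`.
[cite: BhargavaShankarAnnals2015, Prop. 5.13 (arXiv:1006.1002v2 numbering)] -/
theorem isSoluble_coe_of_not_sq_dvd_disc (hp : 5 ≤ p) (f : BinaryQuartic ℤ_[p])
    (hΔ : ¬ (p : ℤ_[p]) ^ 2 ∣ f.disc) : (f.map PadicInt.Coe.ringHom).IsSoluble := by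
  by_cases h1 : (p : ℤ_[p]) ∣ f.disc
  swap
  · exact isSoluble_coe_of_not_dvd_disc hp f h1
  obtain ⟨hp2, hp3⟩ := two_three_ne_zero_zmod hp
  have hp' : p ≠ 2 := by omega
  have h27 : ∀ g : BinaryQuartic ℤ_[p], g.disc = f.disc → ¬ (p : ℤ_[p]) ^ 2 ∣ 27 * g.disc :=
    fun g hg h ↦ hΔ (by rw [← hg]; exact sq_dvd_of_sq_dvd_twentySeven_mul hp h)
  -- not both invariants vanish modulo `p`
  have hIJ : ¬ (PadicInt.toZMod f.I = 0 ∧ PadicInt.toZMod f.J = 0) := by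
    rintro ⟨hI, hJ⟩
    rw [toZMod_eq_zero_iff] at hI hJ
    exact h27 f rfl (sq_dvd_twentySeven_mul_disc_of_dvd hI hJ)
  set g := f.map (PadicInt.toZMod (p := p)) with hg
  -- `ḡ ≠ 0`: a nonzero value `ḡ(x₀, 1)`
  have hx₀ : ∃ x₀ : ZMod p, g.eval x₀ 1 ≠ 0 := by
    by_contra hall
    simp only [not_exists, not_not] at hall
    apply hIJ
    -- the quartic polynomial `ḡ(X, 1)` vanishes identically, so `ḡ = 0`
    set P : (ZMod p)[X] := C g.a * X ^ 4 + C g.b * X ^ 3 + C g.c * X ^ 2 + C g.d * X + C g.e with hP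
    have hPeval : ∀ x : ZMod p, P.eval x = 0 := fun x ↦ by
      rw [← hall x, hP]; simp only [eval, eval_add, eval_mul, eval_C, eval_pow, eval_X]; ring
    have hPdeg : P.natDegree < Fintype.card (ZMod p) := by
      rw [ZMod.card]
      have : P.natDegree ≤ 4 := by rw [hP]; compute_degree
      omega
    have hP0 : P = 0 :=
      Polynomial.eq_zero_of_natDegree_lt_card_of_eval_eq_zero P Function.injective_id hPeval hPdeg
    have hca : g.a = 0 := by simpa [hP] using congrArg (Polynomial.coeff · 4) hP0
    have hcb : g.b = 0 := by simpa [hP] using congrArg (Polynomial.coeff · 3) hP0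
    have hcc : g.c = 0 := by simpa [hP] using congrArg (Polynomial.coeff · 2) hP0
    have hcd : g.d = 0 := by simpa [hP] using congrArg (Polynomial.coeff · 1) hP0
    have hce : g.e = 0 := by simpa [hP] using congrArg (Polynomial.coeff · 0) hP0
    constructor
    · rw [← I_map, ← hg]; simp only [I, hca, hcb, hcc, hcd, hce]; ring
    · rw [← J_map, ← hg]; simp only [J, hca, hcb, hcc, hcd, hce]; ring
  obtain ⟨x₀, hx₀⟩ := hx₀
  obtain ⟨x₁, hx₁⟩ := ZMod.ringHom_surjective (PadicInt.toZMod (p := p)) x₀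
  -- the substitution `γ = (x₁ 1; 1 0)`
  set γ : Matrix (Fin 2) (Fin 2) ℤ_[p] := !![x₁, 1; 1, 0] with hγ
  have hdet : γ.det = -1 := by rw [hγ, Matrix.det_fin_two_of]; ring
  set f₁ := f.subst γ with hf₁
  have hf₁a : PadicInt.toZMod f₁.a ≠ 0 := by
    have : f₁.a = f.eval x₁ 1 := by rw [hf₁, hγ]; simp [subst, BinaryQuartic.eval]
    rw [this]
    have hev := eval_map (PadicInt.toZMod (p := p)) f x₁ 1
    rw [map_one, hx₁, ← hg] at hev
    rw [← hev]
    exact hx₀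
  have hf₁disc : f₁.disc = f.disc := by rw [hf₁, disc_subst, hdet]; ring
  have hf₁I : f₁.I = f.I := by rw [hf₁, I_subst, hdet]; ring
  have hf₁J : f₁.J = f.J := by rw [hf₁, J_subst, hdet]; ring
  -- solubility of `f` follows from that of `f₁`
  suffices h : (f₁.map PadicInt.Coe.ringHom).IsSoluble by
    rw [hf₁, map_subst] at h
    refine (isSoluble_subst_iff _ ?_).mp h
    rw [← RingHom.mapMatrix_apply, ← RingHom.map_det, hdet, map_neg, map_one]
    norm_num
  -- the reduction of `f₁`
  set g₁ := f₁.map (PadicInt.toZMod (p := p)) with hg₁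
  have hg₁a : g₁.a ≠ 0 := by rw [hg₁, map_a]; exact hf₁a
  have hg₁Δ : g₁.disc = 0 := by rw [hg₁, disc_map, hf₁disc, toZMod_eq_zero_iff]; exact h1
  rcases doubleRoot_structure hp2 hp3 hg₁a hg₁Δ with ⟨hI, hJ⟩ | ⟨lam, q₁, q₂, hsq⟩ |
      ⟨r, k₀, k₁, k₂, ha, hb, hc, hd, he, hk, hD⟩
  · -- triple root: `p ∣ I, J`
    exact absurd ⟨by rw [← hf₁I, ← I_map, ← hg₁]; exact hI, by rw [← hf₁J, ← J_map, ← hg₁]; exact hJ⟩ hIJ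
  · -- square of a quadratic: `f₁ ≡ λq² (mod p)`, so `p² ∣ 27Δ`
    exfalso
    obtain ⟨lam', hlam⟩ := ZMod.ringHom_surjective (PadicInt.toZMod (p := p)) lam
    obtain ⟨q₁', hq₁⟩ := ZMod.ringHom_surjective (PadicInt.toZMod (p := p)) q₁
    obtain ⟨q₂', hq₂⟩ := ZMod.ringHom_surjective (PadicInt.toZMod (p := p)) q₂
    have hca := congrArg BinaryQuartic.a hsq
    have hcb := congrArg BinaryQuartic.b hsq
    have hcc := congrArg BinaryQuartic.c hsq
    have hcd := congrArg BinaryQuartic.d hsq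
    have hce := congrArg BinaryQuartic.e hsq
    simp only [smul_a, smul_b, smul_c, smul_d, smul_e, hg₁, map_a, map_b, map_c, map_d, map_e]
      at hca hcb hcc hcd hce
    apply h27 f₁ hf₁disc
    apply sq_dvd_twentySeven_mul_disc_of_congr_smul_sq lam' 1 q₁' q₂' (p : ℤ_[p]) f₁ <;>
      rw [← toZMod_eq_zero_iff] <;>
      simp only [map_sub, map_mul, map_pow, map_add, map_ofNat, map_one, hlam, hq₁, hq₂,
        hca, hcb, hcc, hcd, hce] <;> ring
  · -- a single rational double root: a smooth point exists and lifts
    obtain ⟨t, z, hz, hsmooth⟩ := exists_smooth_point_of_doubleRoot hp2 hp3 ha hb hc hd he hk hD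
    exact isSoluble_coe_of_smooth_zmod_point hp' f₁ hz hsmooth

/-- **Bhargava–Shankar, Prop. 5.13 / Prop. 3.18 as printed (solubility half): if `f ∈ V_{ℤ_p}` is
not `ℚ_p`-soluble then `p² ∣ Δ(f)`** (`p ≥ 5`). [cite: BhargavaShankarAnnals2015, Prop. 5.13 (arXiv:1006.1002v2 numbering)] -/
theorem sq_dvd_disc_of_not_isSoluble (hp : 5 ≤ p) {f : BinaryQuartic ℤ_[p]}
    (h : ¬ (f.map PadicInt.Coe.ringHom).IsSoluble) : (p : ℤ_[p]) ^ 2 ∣ f.disc := by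
  by_contra hΔ
  exact h (isSoluble_coe_of_not_sq_dvd_disc hp f hΔ)

/-- **`p² ∤ Δ(f)` implies `ℚ_p`-solubility, for integral forms** (`p ≥ 5`).
[cite: BhargavaShankarAnnals2015, Prop. 5.13 (arXiv:1006.1002v2 numbering)] -/
theorem isSoluble_padic_of_not_sq_dvd_disc (hp : 5 ≤ p) (f : BinaryQuartic ℤ)
    (hΔ : ¬ (p : ℤ) ^ 2 ∣ f.disc) : (f.map (Int.castRingHom ℚ_[p])).IsSoluble := by
  set f' := f.map (Int.castRingHom ℤ_[p]) with hf'
  have hΔ' : ¬ (p : ℤ_[p]) ^ 2 ∣ f'.disc := by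
    rw [hf', disc_map, eq_intCast]
    intro h
    apply hΔ
    have h' : ‖((f.disc : ℤ) : ℤ_[p])‖ ≤ (p : ℝ) ^ (-(2 : ℕ) : ℤ) := by
      rw [PadicInt.norm_le_pow_iff_mem_span_pow, Ideal.mem_span_singleton]; exact h
    exact PadicInt.norm_int_le_pow_iff_dvd.mp h'
  have h := isSoluble_coe_of_not_sq_dvd_disc hp f' hΔ'
  have hmap : f'.map PadicInt.Coe.ringHom = f.map (Int.castRingHom ℚ_[p]) := by
    rw [hf']
    ext <;> simp [map]
  rwa [hmap] at h

end BinaryQuartic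

end Literature.NumberTheory.EllipticCurves

end
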